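import Literature.NumberTheory.Automorphic.AdeleQuotientFourier
import HarnessLib

/-!
# Fourier analysis on the compact groups `(𝔸_K ⧸ K)^ι`: product characters, Bessel's inequality,
and integrals over the product of Tate's fundamental domains

Topic `NumberTheory/Automorphic`; namespace `Literature.NumberTheory.Automorphic`. Sequel to
`AdeleQuotientFourier` (one variable) for finitely many variables: the abelian unipotent quotients
`Y(K) \ Y(𝔸_K) ≅ (𝔸_K ⧸ K)^{c-1}` of the column groups of `GL_n` along which the Fourier–Whittaker
expansion of a cusp form proceeds (Cogdell (2004), §1.1, proof of Thm. 1.1: "expand … along the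
abelian `Y_n(k) \ Y_n(𝔸) ≅ (k\𝔸)^{n-1}`, whose characters are the `ψ(η · y)`, `η ∈ k^{n-1}`") carry the
characters

  `ψ_η(u) = ∏_i ψ(η_i u_i)`,  `η : ι → K`,

and the Haar probability measure `⊗_i du_i`. This file provides, for a finite index type `ι`:

* `adeleQuotPiHaar K ι = ⊗_i (Haar probability of 𝔸_K ⧸ K)` (a translation-invariant probability
  measure on `ι → 𝔸_K ⧸ K`);
* `adeleQuotPiChar K η` — the character `ψ_η`, `adeleQuotPiChar_mk` (its value at the class of
  `x : ι → 𝔸_K` is `ψ(Σ_i η_i x_i)`), continuity, and **injectivity of `η ↦ ψ_η`**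
  (`adeleQuotPiChar_injective`: evaluate at vectors supported at one index and use the one-variable
  injectivity `adeleQuotChar_injective`);
* **Bessel's inequality** `Σ_{η ∈ S} |∫ conj ψ_η · f|² ≤ ∫ |f|²` for `f ∈ L²` (`CompactGroupCharacters`),
  and `memLp_two_of_continuous`;
* `map_mkPi_restrict_pi_adeleFundamentalDomain`(`'`) — **the push-forward of `(⊗_i λ)|_{D^ι}` under the
  quotient map is `λ(D)^{|ι|}` times `adeleQuotPiHaar`** (`D` Tate's fundamental domain, `λ` an additive
  Haar measure on `𝔸_K`): both sides are determined by their values on measurable boxes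
  (Mathlib `Measure.pi_eq`), where it is the one-variable statement
  `map_mk_restrict_adeleFundamentalDomain` in each coordinate; with the integral forms
  `lintegral_pi_adeleFundamentalDomain_comp_mkPi`, `integral_pi_adeleFundamentalDomain_comp_mkPi`.

Everything is proved; folklore (Tate's thesis / Weil, *Basic Number Theory*, Ch. IV §2, for `ι`
variables at once).

## References

* J. W. Cogdell, *Analytic theory of L-functions for GL_n*, in *An Introduction to the Langlands
  Program* (2004), §1.1 [CogdellAnalyticTheory2004].
* J. W. S. Cassels, A. Fröhlich (eds.), *Algebraic Number Theory* (1967), Ch. XV (Tate), §4.1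
  [CasselsFrohlichANT1967].
-/

noncomputable section

open MeasureTheory Measure Set Filter Topology IsDedekindDomain NumberField
open scoped ENNReal ComplexConjugate

namespace Literature.NumberTheory.Automorphic

section Pi

variable (K : Type) [Field K] [NumberField K] (ι : Type) [Fintype ι]

/-! ### The characters `ψ_η` of `(𝔸_K ⧸ K)^ι` -/

variable {ι} in
/-- **The character `ψ_η` of `(𝔸_K ⧸ K)^ι`**: `u ↦ ∏_i ψ(η_i u_i)` for `η : ι → K` (the characters of
`Y(K) \ Y(𝔸) ≅ (K \ 𝔸)^{n-1}` in Cogdell (2004), §1.1). [folklore] -/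
def adeleQuotPiChar (η : ι → K) : AddChar (ι → adeleQuotient K) Circle where
  toFun u := ∏ i, adeleQuotChar K (η i) (u i)
  map_zero_eq_one' := by simp
  map_add_eq_mul' u v := by
    simp only [Pi.add_apply, AddChar.map_add_eq_mul, Finset.prod_mul_distrib]

variable {ι} in
/-- `ψ_η(u) = ∏_i ψ_{η_i}(u_i)` (definitional). [folklore] -/
theorem adeleQuotPiChar_apply (η : ι → K) (u : ι → adeleQuotient K) :
    adeleQuotPiChar K η u = ∏ i, adeleQuotChar K (η i) (u i) := rfl

variable {ι} in
/-- A finite product of values of an additive character is its value at the sum. [folklore] -/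
theorem prod_adeleAddChar_eq (x : ι → AdeleRing (𝓞 K) K) :
    ∏ i, adeleAddChar K (x i) = adeleAddChar K (∑ i, x i) := by
  classical
  refine Finset.induction_on (Finset.univ : Finset ι) ?_ ?_
  · simp
  · intro i s hi ih
    rw [Finset.prod_insert hi, Finset.sum_insert hi, ih, AddChar.map_add_eq_mul]

variable {ι} in
/-- **`ψ_η` at the class of `x : ι → 𝔸_K` is `ψ(Σ_i η_i x_i)`.** [folklore] -/
theorem adeleQuotPiChar_mk (η : ι → K) (x : ι → AdeleRing (𝓞 K) K) :
    adeleQuotPiChar K η (fun i => (QuotientAddGroup.mk (x i) : adeleQuotient K)) =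
      adeleAddChar K (∑ i, algebraMap K (AdeleRing (𝓞 K) K) (η i) * x i) := by
  rw [adeleQuotPiChar_apply]
  simp only [adeleQuotChar_mk]
  exact prod_adeleAddChar_eq K _

variable {ι} in
/-- Each `ψ_η` is continuous (as a `ℂ`-valued function). [folklore] -/
theorem continuous_adeleQuotPiChar (η : ι → K) :
    Continuous fun u : ι → adeleQuotient K => (adeleQuotPiChar K η u : ℂ) := by
  have hc : ∀ i : ι, Continuous fun u : ι → adeleQuotient K => adeleQuotChar K (η i) (u i) := fun i =>
    Topology.IsInducing.subtypeVal.continuous_iff.2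
      ((continuous_adeleQuotChar K (η i)).comp (continuous_apply i))
  have hprod : Continuous fun u : ι → adeleQuotient K => ∏ i, adeleQuotChar K (η i) (u i) :=
    continuous_finsetProd _ fun i _ => hc i
  exact continuous_subtype_val.comp hprod

variable {ι} in
/-- **`η ↦ ψ_η` is injective**: evaluating at the vectors supported at one index `i` recovers
`ψ_{η_i}`, and `ξ ↦ ψ_ξ` is injective (`adeleQuotChar_injective`). [folklore] -/
theorem adeleQuotPiChar_injective : Function.Injective (adeleQuotPiChar K (ι := ι)) := by
  classical
  intro η η' h
  funext i
  apply adeleQuotChar_injective K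
  refine AddChar.ext _ _ fun u => ?_
  have h1 := DFunLike.congr_fun h (Pi.single i u)
  rw [adeleQuotPiChar_apply, adeleQuotPiChar_apply, Finset.prod_eq_single i, Finset.prod_eq_single i] at h1
  · simpa using h1
  · intro j _ hji
    rw [Pi.single_eq_of_ne hji, AddChar.map_zero_eq_one]
  · intro hi; exact (hi (Finset.mem_univ i)).elim
  · intro j _ hji
    rw [Pi.single_eq_of_ne hji, AddChar.map_zero_eq_one]
  · intro hi; exact (hi (Finset.mem_univ i)).elim

/-! ### The Haar probability measure and Bessel's inequality -/

variable [MeasurableSpace (adeleQuotient K)] [BorelSpace (adeleQuotient K)]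

/-- **The Haar probability measure of `(𝔸_K ⧸ K)^ι`**: the product of the Haar probability measures
of the factors (Mathlib `Measure.pi`). [folklore] -/
def adeleQuotPiHaar : Measure (ι → adeleQuotient K) := Measure.pi fun _ => adeleQuotHaar K

/-- It is a probability measure. [folklore] -/
instance isProbabilityMeasure_adeleQuotPiHaar : IsProbabilityMeasure (adeleQuotPiHaar K ι) := by
  unfold adeleQuotPiHaar; infer_instance

/-- It is translation invariant. [folklore] -/
instance isAddLeftInvariant_adeleQuotPiHaar : (adeleQuotPiHaar K ι).IsAddLeftInvariant := by
  unfold adeleQuotPiHaar; infer_instance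

/-- It is an additive Haar measure. [folklore] -/
instance isAddHaarMeasure_adeleQuotPiHaar : (adeleQuotPiHaar K ι).IsAddHaarMeasure := by
  unfold adeleQuotPiHaar; infer_instance

/-- It is σ-finite (finite). [folklore] -/
instance sigmaFinite_adeleQuotPiHaar : SigmaFinite (adeleQuotPiHaar K ι) := by infer_instance

/-- **Bessel's inequality on `(𝔸_K ⧸ K)^ι`**, finite form: for `f ∈ L²` and a finite set `S` of
frequencies, `Σ_{η ∈ S} |∫ conj ψ_η(u) f(u) du|² ≤ ∫ |f|²` (orthonormality of the distinct characters
`ψ_η`, `CompactGroupCharacters`). [folklore] -/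
theorem sum_norm_sq_integral_conj_adeleQuotPiChar_mul_le {f : (ι → adeleQuotient K) → ℂ}
    (hf : MemLp f 2 (adeleQuotPiHaar K ι)) (S : Finset (ι → K)) :
    ∑ η ∈ S, ‖∫ u, conj (adeleQuotPiChar K η u : ℂ) * f u ∂(adeleQuotPiHaar K ι)‖ ^ 2 ≤
      ∫ u, ‖f u‖ ^ 2 ∂(adeleQuotPiHaar K ι) :=
  sum_norm_sq_integral_conj_addChar_mul_le (adeleQuotPiHaar K ι) (adeleQuotPiChar_injective K)
    (continuous_adeleQuotPiChar K) hf S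

/-- **Bessel's inequality on `(𝔸_K ⧸ K)^ι`**, series form. [folklore] -/
theorem tsum_norm_sq_integral_conj_adeleQuotPiChar_mul_le {f : (ι → adeleQuotient K) → ℂ}
    (hf : MemLp f 2 (adeleQuotPiHaar K ι)) :
    ∑' η : ι → K, ‖∫ u, conj (adeleQuotPiChar K η u : ℂ) * f u ∂(adeleQuotPiHaar K ι)‖ ^ 2 ≤
      ∫ u, ‖f u‖ ^ 2 ∂(adeleQuotPiHaar K ι) :=
  tsum_norm_sq_integral_conj_addChar_mul_le (adeleQuotPiHaar K ι) (adeleQuotPiChar_injective K)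
    (continuous_adeleQuotPiChar K) hf

/-- Summability of the squared Fourier coefficients of an `L²` function. [folklore] -/
theorem summable_norm_sq_integral_conj_adeleQuotPiChar_mul {f : (ι → adeleQuotient K) → ℂ}
    (hf : MemLp f 2 (adeleQuotPiHaar K ι)) :
    Summable fun η : ι → K => ‖∫ u, conj (adeleQuotPiChar K η u : ℂ) * f u ∂(adeleQuotPiHaar K ι)‖ ^ 2 :=
  summable_norm_sq_integral_conj_addChar_mul (adeleQuotPiHaar K ι) (adeleQuotPiChar_injective K)
    (continuous_adeleQuotPiChar K) hf

/-- A continuous function on the compact group `(𝔸_K ⧸ K)^ι` is in `L²`. [folklore] -/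
theorem memLp_two_of_continuous_pi {f : (ι → adeleQuotient K) → ℂ} (hf : Continuous f) :
    MemLp f 2 (adeleQuotPiHaar K ι) := by
  haveI : CompactSpace (ι → adeleQuotient K) := inferInstance
  have hbdd : ∃ C, ∀ x, ‖f x‖ ≤ C := by
    obtain ⟨C, hC⟩ := (isCompact_univ.image hf).isBounded.exists_norm_le
    exact ⟨C, fun x => hC _ ⟨x, Set.mem_univ _, rfl⟩⟩
  obtain ⟨C, hC⟩ := hbdd
  exact MemLp.of_bound hf.aestronglyMeasurable C (Eventually.of_forall hC)

/-! ### Integrals over the product of Tate's fundamental domains -/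

end Pi

section MkPi

variable (K : Type) [Field K] [NumberField K] (ι : Type)

/-- The coordinatewise quotient map `(ι → 𝔸_K) → (ι → 𝔸_K ⧸ K)`. [folklore] -/
def mkPi : (ι → AdeleRing (𝓞 K) K) → (ι → adeleQuotient K) :=
  fun x i => (QuotientAddGroup.mk (x i) : adeleQuotient K)

variable {ι} in
/-- `mkPi x i = mk (x i)` (definitional). [folklore] -/
@[simp]
theorem mkPi_apply (x : ι → AdeleRing (𝓞 K) K) (i : ι) :
    mkPi K ι x i = (QuotientAddGroup.mk (x i) : adeleQuotient K) := rfl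

/-- `mkPi` is continuous. [folklore] -/
theorem continuous_mkPi : Continuous (mkPi K ι) :=
  continuous_pi fun i => (QuotientAddGroup.continuous_mk (N := AdeleRing.principalSubgroup (𝓞 K) K)).comp
    (continuous_apply i)

/-- `mkPi` is measurable (Borel structures). [folklore] -/
theorem measurable_mkPi [MeasurableSpace (adeleQuotient K)] [BorelSpace (adeleQuotient K)]
    [MeasurableSpace (AdeleRing (𝓞 K) K)] [OpensMeasurableSpace (AdeleRing (𝓞 K) K)] [Countable ι] :
    Measurable (mkPi K ι) :=
  measurable_pi_lambda _ fun i => (measurable_mk K).comp (measurable_pi_apply i)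

end MkPi

section PiMeasure

variable (K : Type) [Field K] [NumberField K] (ι : Type) [Fintype ι]
  [MeasurableSpace (adeleQuotient K)] [BorelSpace (adeleQuotient K)]
  [MeasurableSpace (AdeleRing (𝓞 K) K)] [BorelSpace (AdeleRing (𝓞 K) K)]
  (μ : Measure (AdeleRing (𝓞 K) K)) [μ.IsAddHaarMeasure]

attribute [local instance] secondCountableTopology_adeleRing locallyCompactSpace_adeleRing'

omit [MeasurableSpace (adeleQuotient K)] [BorelSpace (adeleQuotient K)] [BorelSpace (AdeleRing (𝓞 K) K)] in
/-- `(⊗ λ)(D^ι) < ∞`. [folklore] -/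
theorem pi_restrict_pi_adeleFundamentalDomain_lt_top :
    (Measure.pi fun _ : ι => μ) (Set.pi Set.univ fun _ : ι => adeleFundamentalDomain K) < ⊤ := by
  rw [Measure.pi_pi]
  exact ENNReal.prod_lt_top fun i _ => measure_adeleFundamentalDomain_lt_top K μ

/-- The finite constant `λ(D)` as a non-negative real. [folklore] -/
def fdVol : NNReal := (μ (adeleFundamentalDomain K)).toNNReal

omit [MeasurableSpace (adeleQuotient K)] [BorelSpace (adeleQuotient K)] [BorelSpace (AdeleRing (𝓞 K) K)] in
/-- `↑(fdVol) = λ(D)`. [folklore] -/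
theorem coe_fdVol : ((fdVol K μ : NNReal) : ℝ≥0∞) = μ (adeleFundamentalDomain K) :=
  ENNReal.coe_toNNReal (measure_adeleFundamentalDomain_lt_top K μ).ne

/-- **The push-forward of `(⊗_i λ)|_{D^ι}` to `(𝔸_K ⧸ K)^ι` is the product of the measures
`λ(D) · Haar`.** Both sides are determined by their values on measurable boxes `∏_i S_i` (Mathlib
`Measure.pi_eq`), where the left side gives `∏_i λ(D ∩ mk⁻¹ S_i) = ∏_i λ(D) · Haar(S_i)` by the
one-variable statement `map_mk_restrict_adeleFundamentalDomain`. [folklore] -/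
theorem map_mkPi_restrict_pi_adeleFundamentalDomain :
    ((Measure.pi fun _ : ι => μ).restrict (Set.pi Set.univ fun _ : ι => adeleFundamentalDomain K)).map
        (mkPi K ι) =
      Measure.pi fun _ : ι => (fdVol K μ) • adeleQuotHaar K := by
  symm
  refine Measure.pi_eq fun s hs => ?_
  rw [Measure.map_apply (measurable_mkPi K ι) (MeasurableSet.univ_pi hs),
    Measure.restrict_apply ((measurable_mkPi K ι) (MeasurableSet.univ_pi hs))]
  have hset : mkPi K ι ⁻¹' Set.pi Set.univ s ∩ Set.pi Set.univ (fun _ : ι => adeleFundamentalDomain K) =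
      Set.pi Set.univ fun i => (QuotientAddGroup.mk ⁻¹' s i) ∩ adeleFundamentalDomain K := by
    ext x
    simp only [Set.mem_inter_iff, Set.mem_preimage, Set.mem_univ_pi, mkPi_apply]
    exact ⟨fun h i => ⟨h.1 i, h.2 i⟩, fun h => ⟨fun i => (h i).1, fun i => (h i).2⟩⟩
  rw [hset, Measure.pi_pi]
  refine Finset.prod_congr rfl fun i _ => ?_
  have h1 := map_mk_restrict_adeleFundamentalDomain K μ
  have h2 : ((μ.restrict (adeleFundamentalDomain K)).map
      (QuotientAddGroup.mk : AdeleRing (𝓞 K) K → adeleQuotient K)) (s i) =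
      μ (QuotientAddGroup.mk ⁻¹' s i ∩ adeleFundamentalDomain K) := by
    rw [Measure.map_apply (measurable_mk K) (hs i), Measure.restrict_apply ((measurable_mk K) (hs i))]
  rw [← h2, h1, Measure.smul_apply, Measure.coe_nnreal_smul_apply, coe_fdVol, smul_eq_mul]

/-- **Scalar form**: the push-forward is `λ(D)^{|ι|} • adeleQuotPiHaar`. [folklore] -/
theorem map_mkPi_restrict_pi_adeleFundamentalDomain' :
    ((Measure.pi fun _ : ι => μ).restrict (Set.pi Set.univ fun _ : ι => adeleFundamentalDomain K)).map
        (mkPi K ι) =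
      (μ (adeleFundamentalDomain K)) ^ Fintype.card ι • adeleQuotPiHaar K ι := by
  rw [map_mkPi_restrict_pi_adeleFundamentalDomain]
  -- `⊗ (c • ν) = c^{|ι|} • ⊗ ν`, by values on boxes
  refine Measure.pi_eq fun s hs => ?_
  rw [Measure.smul_apply, adeleQuotPiHaar, Measure.pi_pi, smul_eq_mul]
  simp only [Measure.coe_nnreal_smul_apply, coe_fdVol]
  rw [Finset.prod_mul_distrib, Finset.prod_const, Finset.card_univ]

/-- **Integration over `D^ι`**, `ℝ≥0∞`-valued form:
`∫⁻_{D^ι} F(x + K^ι) d(⊗λ)(x) = λ(D)^{|ι|} ∫⁻ F d(adeleQuotPiHaar)` for measurable `F ≥ 0`. [folklore] -/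
theorem lintegral_pi_adeleFundamentalDomain_comp_mkPi {F : (ι → adeleQuotient K) → ℝ≥0∞}
    (hF : Measurable F) :
    ∫⁻ x in Set.pi Set.univ (fun _ : ι => adeleFundamentalDomain K), F (mkPi K ι x)
        ∂(Measure.pi fun _ : ι => μ) =
      (μ (adeleFundamentalDomain K)) ^ Fintype.card ι * ∫⁻ u, F u ∂(adeleQuotPiHaar K ι) := by
  rw [← smul_eq_mul, ← lintegral_smul_measure, ← map_mkPi_restrict_pi_adeleFundamentalDomain' K ι μ,
    lintegral_map hF (measurable_mkPi K ι)]

/-- **Integration over `D^ι`**, Bochner form: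
`∫_{D^ι} F(x + K^ι) d(⊗λ)(x) = λ(D)^{|ι|} • ∫ F d(adeleQuotPiHaar)`. [folklore] -/
theorem integral_pi_adeleFundamentalDomain_comp_mkPi {E : Type*} [NormedAddCommGroup E]
    [NormedSpace ℝ E] {F : (ι → adeleQuotient K) → E}
    (hF : AEStronglyMeasurable F (adeleQuotPiHaar K ι)) :
    ∫ x in Set.pi Set.univ (fun _ : ι => adeleFundamentalDomain K), F (mkPi K ι x)
        ∂(Measure.pi fun _ : ι => μ) =
      ((μ (adeleFundamentalDomain K)) ^ Fintype.card ι).toReal • ∫ u, F u ∂(adeleQuotPiHaar K ι) := by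
  have hmap := map_mkPi_restrict_pi_adeleFundamentalDomain' K ι μ
  have hF' : AEStronglyMeasurable F
      (((Measure.pi fun _ : ι => μ).restrict (Set.pi Set.univ fun _ : ι => adeleFundamentalDomain K)).map
        (mkPi K ι)) := by
    rw [hmap]; exact hF.smul_measure _
  have h1 := integral_map (μ := (Measure.pi fun _ : ι => μ).restrict
    (Set.pi Set.univ fun _ : ι => adeleFundamentalDomain K)) (measurable_mkPi K ι).aemeasurable hF'
  rw [← h1, hmap, integral_smul_measure]

omit [MeasurableSpace (adeleQuotient K)] [BorelSpace (adeleQuotient K)] [BorelSpace (AdeleRing (𝓞 K) K)] in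
/-- The total mass identity: `(⊗λ)(D^ι) = λ(D)^{|ι|}`. [folklore] -/
theorem pi_pi_adeleFundamentalDomain :
    (Measure.pi fun _ : ι => μ) (Set.pi Set.univ fun _ : ι => adeleFundamentalDomain K) =
      (μ (adeleFundamentalDomain K)) ^ Fintype.card ι := by
  rw [Measure.pi_pi, Finset.prod_const, Finset.card_univ]

end PiMeasure

end Literature.NumberTheory.Automorphic
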